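import Summits.HubbardSuperconductivity.HubbardSuperconductivity.Theses.ParityGapRigidity
import Summits.HubbardSuperconductivity.HubbardSuperconductivity.Theorems.ParityGapRigidityParityGapClusteringFilter
import Summits.HubbardSuperconductivity.HubbardSuperconductivity.Theorems.ParityGapRigidityParityGapClusteringSector
import Literature.MathematicalPhysics.QuantumLattice.HubbardCommutatorBound
import Literature.MathematicalPhysics.QuantumLattice.HubbardWave0PosSemidefProofs
import Literature.MathematicalPhysics.QuantumLattice.FermionOperatorsProofs

/-!
# Route `ParityGapRigidity` — item `ParityGapClustering` (stmt-HubbardSuperconductivity-2197)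

The sector-relative Hastings–Koma lemma of the route: for every `U` and `Δ > 0` there are `C`,
`m > 0` such that on every torus `(ℤ/Lℤ)²` and in every sector `(N, S^z = 0)`, a normalised sector
ground state `ψ` of `hubbardTorus 2 L 1 U` whose one-particle charge gap about its own energy is
`≥ 2Δ` — `E(N+1) + E(N-1) - 2E₀(N,0) ≥ 2Δ`, energies only — has
`|⟨ψ, c†_{xσ} c_{yτ} ψ⟩| ≤ C e^{-m dist(x,y)}`.

Proof (the printed pattern of the item, assembled from the tree):
* after the scalar shift by `μ_L = (E(N+1) - E(N-1))/2` the vectors `c_{yτ}ψ` (`(N-1)` particles)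
  and `c†_{xσ}ψ` (`(N+1)` particles) are spectrally supported at energies `≥ E₀ + Δ`: an eigenvector
  of `H` below the variational sector energy `E(N∓1)` is orthogonal to that sector
  (`dotProduct_eq_zero_of_eigenvalue_lt_groundEnergy`, `H` conserves `N` entrywise), and the parity
  gap is exactly `E(N-1) + μ_L - E₀ ≥ Δ`, `E(N+1) - μ_L - E₀ ≥ Δ`;
* the fermionic Lieb–Robinson bound for `{c†_{xσ}, τ_t(c_{yτ})}` on the torus with constants
  uniform in `L` and `N` (`norm_anticomm_creation_heisenbergEvolution_annihilation_le`, chemical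
  potential `0` — `μ_L` enters only as a phase), and `‖[H, c_{yτ}]‖ ≤ 18(2+|U|)`
  (`norm_commutator_hubbardTorusWith_annihilation_le`);
* the one-sided Gaussian filter `norm_expect_mul_le_of_oneSidedGaps` (Hastings–Koma §3 on the
  index set `Option (m ⊕ m)`); no global gap and no gap inside the sector of `ψ` is used, so the
  `N ± 2` tower and the spin waves never enter;
* short distances `dist < max(2v, 1)` by the trivial bound `|ρ₁| ≤ 1`; `L = 0` is vacuous.

References: M. B. Hastings, T. Koma, CMP 265 (2006) 781, §3, Thm. 2 and App. A;
B. Nachtergaele, R. Sims, CMP 265 (2006) 119; K. A. Matveev, A. I. Larkin, PRL 78 (1997) 3749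
(the parity gap).
-/

noncomputable section

-- the mandated namespace `Summit.<Summit>.<Problem>.Theorems` repeats `HubbardSuperconductivity`
-- (single-problem summit, D-0017), which the `dupNamespace` linter flags on every declaration
set_option linter.dupNamespace false

open Matrix Complex Finset Real
open scoped Matrix.Norms.L2Operator ComplexOrder

namespace Summit.HubbardSuperconductivity.HubbardSuperconductivity.Theorems

open Literature.MathematicalPhysics.QuantumLattice Literature.Probability.LatticeModels

/-- **Sector-relative Hastings–Koma bound, one volume and one pair of orbitals at distance
`≥ max(2v_U, 1)`** (`v_U = 36e(2+|U|) + 1` the fermionic Lieb–Robinson velocity at chemical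
potential `0`): a normalised `(N, S^z=0)`-sector ground state `ψ` of `hubbardTorus 2 L 1 U` with
parity gap `E(N+1) + E(N-1) - 2E₀ ≥ 2Δ > 0` has
`|ρ₁(ψ)((x,σ),(y,τ))| ≤ K_U(Δ) e^{-dist(x,y)/ξ}`, `ξ = max(8, 4v_U/Δ)`,
`K_U(Δ) = 2 + 36(2+|U|) + 4·36(2+|U|)e/v_U + 8v_U/Δ` — constants uniform in `L` and `N`.
Hastings–Koma, CMP 265 (2006) 781, §3 / Thm. 2, in the one-sided (odd charge sectors only) form.
[folklore] -/
theorem norm_oneParticleRDM_le_of_parityGap (U : ℝ) {Δ : ℝ} (hΔ : 0 < Δ) {L : ℕ} [NeZero L]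
    {N : ℕ} {ψ : Fock (Orb (FermionTorus 2 L))}
    (hgs : IsGroundStateInSector (hubbardTorus 2 L 1 U) N 0 ψ) (hψ1 : star ψ ⬝ᵥ ψ = 1)
    (hPG : 2 * Δ ≤ groundEnergy (hubbardTorus 2 L 1 U) (N + 1) +
      groundEnergy (hubbardTorus 2 L 1 U) (N - 1) -
        2 * (hubbardTorus 2 L 1 U).minEnergyOn (szSector N 0))
    (x y : FermionTorus 2 L) (σ τ : Fin 2)
    (hD : max (2 * (Real.exp 1 * (2 * (2 + |U|) * 18) + 1)) 1 ≤
      (torusDist x.toTorusSite y.toTorusSite : ℝ)) :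
    ‖oneParticleRDM ψ (orb x σ) (orb y τ)‖ ≤
      (2 + 2 * (18 * (2 + |U|)) +
          4 * (36 * (2 + |U|) * Real.exp 1) / ((Real.exp 1 * (2 * (2 + |U|) * 18) + 1) * 1) +
          8 * (Real.exp 1 * (2 * (2 + |U|) * 18) + 1) / Δ) *
        Real.exp (-(torusDist x.toTorusSite y.toTorusSite : ℝ) /
          max (8 / 1) (4 * (Real.exp 1 * (2 * (2 + |U|) * 18) + 1) / Δ)) := by
  -- instance bookkeeping (cf. `norm_anticommutator_hubbardTorus_le`): one `DecidableEq` path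
  letI instDE : DecidableEq (FermionTorus 2 L) := LinearOrder.toDecidableEq
  set v : ℝ := Real.exp 1 * (2 * (2 + |U|) * 18) + 1 with hv
  set CLR : ℝ := 36 * (2 + |U|) * Real.exp 1 with hCLR
  set Q : ℝ := 18 * (2 + |U|) with hQ
  set d : ℝ := (torusDist x.toTorusSite y.toTorusSite : ℝ) with hd
  set H := hubbardTorus 2 L 1 U with hH_def
  have hH : H.IsHermitian := LiebThm1.hamiltonian_isHermitian _ 1 U
  obtain ⟨hmem, -, heig⟩ := hgs
  obtain ⟨hN, -⟩ := (mem_szSector_iff N 0 ψ).1 hmem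
  set A : Matrix (Finset (Orb (FermionTorus 2 L))) (Finset (Orb (FermionTorus 2 L))) ℂ :=
    creation (orb x σ) with hA_def
  set B : Matrix (Finset (Orb (FermionTorus 2 L))) (Finset (Orb (FermionTorus 2 L))) ℂ :=
    annihilation (orb y τ) with hB_def
  -- the orbitals are distinct (distance `≥ 1`)
  have hv0 : 0 < v := by positivity
  have hd1 : 1 ≤ d := le_trans (le_max_right _ _) hD
  have hxy : x ≠ y := by
    intro h
    have h0 : d = 0 := by rw [hd, h, torusDist_self, Nat.cast_zero]
    linarith
  have hne : orb x σ ≠ orb y τ := fun h => hxy (congrArg (fun o => (ofLex o).1) h)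
  -- inputs of the filter lemma
  have hA1 : ‖A‖ ≤ 1 := norm_creation_le_one _
  have hB1 : ‖B‖ ≤ 1 := norm_annihilation_le_one _
  have hAB : A * B + B * A = 0 := creation_mul_annihilation_add hne
  have hcomm : ‖H * B - B * H‖ ≤ Q := by
    have h := norm_commutator_hubbardTorusWith_annihilation_le U 0 L y τ
    rw [hubbardTorusWith_zero, abs_zero, mul_zero, add_zero] at h
    exact h
  have hLR : ∀ t : ℝ, ‖A * heisenbergEvolution H t B + heisenbergEvolution H t B * A‖ ≤
      CLR * Real.exp (-1 * (d - v * |t|)) := fun t =>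
    norm_anticomm_creation_heisenbergEvolution_annihilation_le U x y σ τ hne t
  -- sector data: `Bψ` has `N - 1` particles, `Aψ` has `N + 1`
  have hBψ : IsNParticle (N - 1) (B *ᵥ ψ) := PosSemidefTrace.isNParticle_annihilation_mulVec hN _
  have hAψ : IsNParticle (N + 1) (A *ᵥ ψ) := IsNParticle.creation_mulVec_holds hN _
  have hcons : ∀ s s' : Finset (Orb (FermionTorus 2 L)), H s s' ≠ 0 → s.card = s'.card :=
    card_eq_card_of_hamiltonian_ne_zero (fermionTorusGraph 2 L) 1 U
  have heigv : ∀ i, H *ᵥ ⇑(hH.eigenvectorBasis i) =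
      ((hH.eigenvalues i : ℝ) : ℂ) • ⇑(hH.eigenvectorBasis i) := by
    intro i
    rw [hH.mulVec_eigenvectorBasis i]
    funext k
    simp only [Pi.smul_apply, Complex.real_smul, smul_eq_mul]
  -- the shift `μ_L = (E(N+1) - E(N-1))/2` and the two one-sided gaps
  obtain ⟨μs, hμs⟩ : ∃ μs : ℝ, 2 * μs = groundEnergy H (N + 1) - groundEnergy H (N - 1) :=
    ⟨(groundEnergy H (N + 1) - groundEnergy H (N - 1)) / 2, by ring⟩
  have hgapB : ∀ i, star (⇑(hH.eigenvectorBasis i)) ⬝ᵥ (B *ᵥ ψ) ≠ 0 →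
      Δ ≤ hH.eigenvalues i - H.minEnergyOn (szSector N 0) + μs := by
    intro i hi
    refine not_lt.1 fun hlt => hi ?_
    have hlam : hH.eigenvalues i < groundEnergy H (N - 1) := by linarith
    exact dotProduct_eq_zero_of_eigenvalue_lt_groundEnergy H hcons (heigv i) hlam hBψ
  have hgapA : ∀ i, star (⇑(hH.eigenvectorBasis i)) ⬝ᵥ (A *ᵥ ψ) ≠ 0 →
      Δ ≤ hH.eigenvalues i - H.minEnergyOn (szSector N 0) - μs := by
    intro i hi
    refine not_lt.1 fun hlt => hi ?_
    have hlam : hH.eigenvalues i < groundEnergy H (N + 1) := by linarith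
    exact dotProduct_eq_zero_of_eigenvalue_lt_groundEnergy H hcons (heigv i) hlam hAψ
  -- the filter lemma
  have key := norm_expect_mul_le_of_oneSidedGaps hH heig hψ1 hΔ (C := CLR) (by positivity)
    one_pos hv0 (Q := Q) (by positivity) hA1 hB1 hAB hgapB hgapA hcomm hLR hD
  exact key

/-- **`ParityGapClustering` (item `stmt-HubbardSuperconductivity-2197`) — the sector-relative
Hastings–Koma lemma of route `ParityGapRigidity`.** For every `U` and `Δ > 0` there are `C`, `m > 0`
such that on every torus `(ℤ/Lℤ)²` and in every sector `(N, S^z=0)`, a normalised sector ground state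
`ψ` of `hubbardTorus 2 L 1 U` with one-particle charge gap `E(N+1) + E(N-1) - 2E₀(N,0) ≥ 2Δ` has
`|ρ₁(ψ)((x,σ),(y,τ))| ≤ C e^{-m dist(x,y)}`: `m = 1/ξ`, `ξ = max(8, 4v_U/Δ)`,
`C = K_U(Δ) + 2e^{max(2v_U,1)/ξ}` (`norm_oneParticleRDM_le_of_parityGap` at distances
`≥ max(2v_U, 1)`, the trivial bound `|ρ₁| ≤ 1` below; `L = 0` is vacuous). Only the one-sided gaps
on the `(N ± 1)`-particle spaces are used — no global gap, so the `N ± 2` tower and gapless neutral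
modes inside the sector are harmless. Hastings–Koma, CMP 265 (2006) 781, Thm. 2 (sector-relative
form). [folklore] -/
theorem parityGapClustering_proof :
    Summit.HubbardSuperconductivity.HubbardSuperconductivity.Theses.ParityGapRigidity.ParityGapClustering := by
  intro U Δ hΔ
  -- constants, uniform in `L` and `N`
  set v : ℝ := Real.exp 1 * (2 * (2 + |U|) * 18) + 1 with hv
  set K₀ : ℝ := 2 + 2 * (18 * (2 + |U|)) + 4 * (36 * (2 + |U|) * Real.exp 1) / (v * 1) +
    8 * v / Δ with hK₀
  set ξ : ℝ := max (8 / 1) (4 * v / Δ) with hξ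
  set D₀ : ℝ := max (2 * v) 1 with hD₀
  have hv0 : 0 < v := by positivity
  have hξ0 : 0 < ξ := lt_of_lt_of_le (by norm_num) (le_max_left _ _)
  have hK₀0 : 0 ≤ K₀ := by positivity
  refine ⟨K₀ + 2 * Real.exp (D₀ / ξ), 1 / ξ, by positivity, ?_⟩
  intro L N Hm hHm ψ hgs hψ1 hPG x y σ τ
  subst hHm
  -- `L = 0`: the torus is empty
  rcases Nat.eq_zero_or_pos L with hL | hL
  · subst hL
    exact ((ofLex x) 0).elim0
  haveI : NeZero L := ⟨by omega⟩
  set d : ℝ := (torusDist x.toTorusSite y.toTorusSite : ℝ) with hd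
  have hexp : Real.exp (-(1 / ξ * d)) = Real.exp (-d / ξ) := by
    congr 1
    ring
  rw [hexp]
  rcases le_or_gt D₀ d with hDd | hDd
  · -- long distance: the filter bound
    have key := norm_oneParticleRDM_le_of_parityGap U hΔ hgs hψ1 hPG x y σ τ hDd
    refine key.trans (mul_le_mul_of_nonneg_right ?_ (Real.exp_pos _).le)
    linarith [Real.exp_pos (D₀ / ξ)]
  · -- short distance: `|ρ₁| ≤ ‖c†‖ ‖c‖ ≤ 1 ≤ 2 e^{(D₀ - d)/ξ}`
    letI instDE : DecidableEq (FermionTorus 2 L) := LinearOrder.toDecidableEq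
    have htriv : ‖oneParticleRDM ψ (orb x σ) (orb y τ)‖ ≤ 1 := by
      rw [oneParticleRDM_apply]
      refine (norm_vectorState_le hψ1 _).trans ((norm_mul_le _ _).trans ?_)
      exact mul_le_one₀ (norm_creation_le_one _) (norm_nonneg _) (norm_annihilation_le_one _)
    refine htriv.trans ?_
    have h := two_mul_le_of_short (nA := 1) (nB := 1) (cY := 1) hK₀0 hξ0 hDd.le le_rfl
      zero_le_one zero_le_one
    linarith

end Summit.HubbardSuperconductivity.HubbardSuperconductivity.Theorems

end
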